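import Summits.RiemannHypothesis.RiemannHypothesis.Theorems.ScrewManifestCornerAssembly
import Summits.RiemannHypothesis.RiemannHypothesis.Theorems.ScrewManifestCornerGapMass
import Summits.RiemannHypothesis.RiemannHypothesis.Theorems.ScrewManifestCosSumRecovery
import HarnessLib

/-!
# RH-FREE: the corner gap L2 HOLDS (`cornerGap_holds : Manifest.CornerGap`), hence `PlateauBound → SuperlinearFloor`

`Manifest.CornerGap` (`ScrewManifestCornerGap`, p465345): for every band limit `θ > 0` there are `ε, δ > 0`
such that no nonnegative atom sum `Φ(s) = Σ_k W_k(1 − cos(τ_k s))/τ_k²`, `0 < τ_k ≤ θ`, is within `ε` of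
`s/2` at every point of a `δ`-dense finite subset of `[1, 3]`.

EXPLICIT proof (no compactness in function space, no analytic continuation), by contradiction:
1. MASS CONTROL (`sum_weights_le_of_nearMiss`): `Σ W ≤ 8/κ(θ)`;
2. equicontinuity (`abs_cosAtomSum_sub_le`) upgrades the near-miss on `P` to `|Φ(s) − s/2| ≤ t` on all of
   `[1, 3]`, `t = ε + (3·8/κ + 1/2)δ`;
3. the EXACT second difference (`cosAtomSum_second_diff`, step `h = min(1/2, 1/θ)`) kills `s/2`:
   `ψ(s) = Σ_k V_k cos(τ_k s)`, `V_k = W_k·2(1 − cos τ_k h)/(τ_k h)² ∈ [¾W_k, W_k]`, has `|ψ| ≤ 4t/h²` on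
   `[2, 5/2]`;
4. MASS RECOVERY (`cosSum_mass_le_of_small_on_window`): `Σ V ≤ C(θ)·4t/h²`, while `Σ V ≥ ¾ Σ W ≥ ¾(1 − 2t)`;
   with `t ≤ min(1/4, 3h²/(64C))` this is `3/8 ≤ 3/16`, absurd.

Consequences (with the tree's assembly p468372 and `lagDensity_holds` p466957):
`cornerCostLaw_holds : CornerCostLaw` and `superlinearFloor_of_plateauBound : PlateauBound → SuperlinearFloor`
— the RH-free superlinear floor of manifest SOS certificates is reduced to the single slot S2 `PlateauBound`.

RH-FREE statements about the certificate FORMAT for truncated screw matrices; nothing here bears on the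
truth of RH.  References: [folklore]; plan: sos-theory note SCREW-P3-FOLD-NOTE-g19 §2 (L2), explicit route
by sos-filer-1 g4.
-/

set_option linter.dupNamespace false
set_option autoImplicit false

noncomputable section

open Real Set Finset

namespace Summit.RiemannHypothesis.RiemannHypothesis.Theorems.IntegerScrew.Manifest

/-- **L2 HOLDS (RH-free): the corner gap.** [folklore] -/
theorem cornerGap_holds : CornerGap := by
  intro θ hθ
  obtain ⟨κ, x₁, hκ, hx₁2, hx₁3, hanchor⟩ := exists_anchor_lower_bound hθ
  obtain ⟨C, hC, hrec⟩ := cosSum_mass_le_of_small_on_window hθ.le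
  -- the second-difference step `h`
  set h : ℝ := min (1 / 2) (1 / θ) with hh
  have hh0 : 0 < h := lt_min (by norm_num) (by positivity)
  have hh2 : h ≤ 1 / 2 := min_le_left _ _
  have hθh : θ * h ≤ 1 := by
    have h1 : h ≤ 1 / θ := min_le_right _ _
    calc θ * h ≤ θ * (1 / θ) := mul_le_mul_of_nonneg_left h1 hθ.le
      _ = 1 := by field_simp
  -- the uniform-closeness target `t`
  set t : ℝ := min (1 / 4) (3 * h ^ 2 / (64 * C)) with ht
  have ht0 : 0 < t := lt_min (by norm_num) (by positivity)
  have ht4 : t ≤ 1 / 4 := min_le_left _ _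
  have htC : C * (4 * t / h ^ 2) ≤ 3 / 16 := by
    have h1 : t ≤ 3 * h ^ 2 / (64 * C) := min_le_right _ _
    rw [le_div_iff₀ (by positivity)] at h1
    rw [mul_div_assoc', div_le_iff₀ (by positivity)]
    linarith
  -- the mass bound and the constants `ε`, `δ`
  set Wmax : ℝ := 8 / κ with hWmax
  have hWmax0 : 0 < Wmax := by positivity
  set ε : ℝ := t / 2 with hε
  set δ : ℝ := min (κ / 16) (t / (2 * (3 * Wmax + 1 / 2))) with hδ
  have hε0 : 0 < ε := by positivity
  have hδ0 : 0 < δ := lt_min (by positivity) (by positivity)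
  have hδκ : δ ≤ κ / 16 := min_le_left _ _
  have hδt : (3 * Wmax + 1 / 2) * δ ≤ t / 2 := by
    have h1 : δ ≤ t / (2 * (3 * Wmax + 1 / 2)) := min_le_right _ _
    rw [le_div_iff₀ (by positivity)] at h1
    linarith
  refine ⟨ε, δ, hε0, hδ0, fun K τ W P hτW hP hdense => ?_⟩
  by_contra hcon
  push Not at hcon
  set Φ : ℝ → ℝ := fun s => ∑ k, W k * (1 - Real.cos (τ k * s)) / (τ k) ^ 2 with hΦ
  have hτne : ∀ k, τ k ≠ 0 := fun k => (hτW k).1.ne'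
  have hW : ∀ k, 0 ≤ W k := fun k => (hτW k).2.2
  -- (1) mass control
  have hSW : ∑ k, W k ≤ Wmax :=
    sum_weights_le_of_nearMiss hκ hx₁2 hx₁3 hanchor (by linarith) hδκ τ W P hτW hP hdense hcon
  have hSW0 : 0 ≤ ∑ k, W k := sum_nonneg fun k _ => hW k
  -- (2) uniform closeness on `[1, 3]`
  have hunif : ∀ s : ℝ, 1 ≤ s → s ≤ 3 → |Φ s - s / 2| ≤ t := by
    intro s hs1 hs3
    obtain ⟨p, hpP, hsp⟩ := hdense s hs1 hs3
    have hp := hP p hpP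
    have h1 : |Φ s - Φ p| ≤ 3 * (∑ k, W k) * |s - p| :=
      abs_cosAtomSum_sub_le τ W hτne hW (B := 3) (by rw [abs_of_nonneg (by linarith)]; exact hs3)
        (by rw [abs_of_nonneg (by linarith [hp.1])]; exact hp.2)
    have h2 : |Φ p - p / 2| < ε := hcon p hpP
    have h3 : 3 * (∑ k, W k) * |s - p| ≤ 3 * Wmax * δ := by
      have := mul_le_mul hSW hsp (abs_nonneg _) hWmax0.le
      linarith
    have h4 : |p / 2 - s / 2| ≤ δ / 2 := by
      rw [show p / 2 - s / 2 = -((s - p) / 2) by ring, abs_neg, abs_div, abs_two]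
      linarith
    rw [show Φ s - s / 2 = (Φ s - Φ p) + (Φ p - p / 2) + (p / 2 - s / 2) by ring]
    refine le_trans (abs_add_three _ _ _) ?_
    linarith
  -- (3) the second difference with step `h` on the window `[2, 5/2]`
  set V : Fin K → ℝ := fun k => W k * (2 * (1 - Real.cos (τ k * h)) / (τ k * h) ^ 2) with hV
  have hV0 : ∀ k, 0 ≤ V k := fun k =>
    mul_nonneg (hW k) (div_nonneg (by nlinarith [Real.cos_le_one (τ k * h)]) (sq_nonneg _))
  have hVW : ∀ k, 3 / 4 * W k ≤ V k := by
    intro k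
    have hx0 : 0 < τ k * h := mul_pos (hτW k).1 hh0
    have hx1 : τ k * h ≤ 1 := le_trans (mul_le_mul_of_nonneg_right (hτW k).2.1 hh0.le) hθh
    have h1 := three_quarters_le_sincSq hx0 hx1
    have h2 := mul_le_mul_of_nonneg_left h1 (hW k)
    rw [hV]
    linarith
  have hsmall : ∀ s : ℝ, 2 ≤ s → s ≤ 5 / 2 → |∑ k, V k * Real.cos (τ k * s)| ≤ 4 * t / h ^ 2 := by
    intro s hs2 hs52
    have hsd := cosAtomSum_second_diff τ W hτne hh0.ne' s
    have e : h ^ 2 * ∑ k, V k * Real.cos (τ k * s)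
        = (Φ (s + h) - (s + h) / 2) + (-(2 * (Φ s - s / 2))) + (Φ (s - h) - (s - h) / 2) := by
      have e2 : (Φ (s + h) - (s + h) / 2) + (-(2 * (Φ s - s / 2))) + (Φ (s - h) - (s - h) / 2)
          = Φ (s + h) - 2 * Φ s + Φ (s - h) := by ring
      rw [e2]
      simp only [hΦ, hV]
      exact hsd.symm
    have hb1 := hunif (s + h) (by linarith) (by linarith)
    have hb2 := hunif s (by linarith) (by linarith)
    have hb3 := hunif (s - h) (by linarith) (by linarith)
    have habs : |h ^ 2 * ∑ k, V k * Real.cos (τ k * s)| ≤ 4 * t := by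
      rw [e]
      refine le_trans (abs_add_three _ _ _) ?_
      rw [abs_neg, abs_mul, abs_two]
      linarith
    rw [abs_mul, abs_of_pos (by positivity : (0 : ℝ) < h ^ 2)] at habs
    rw [le_div_iff₀ (by positivity)]
    linarith
  -- (4) mass recovery against the lower mass bound
  have hτ' : ∀ k, 0 ≤ τ k ∧ τ k ≤ θ := fun k => ⟨(hτW k).1.le, (hτW k).2.1⟩
  have hup : ∑ k, V k ≤ C * (4 * t / h ^ 2) := hrec K V τ hV0 hτ' _ hsmall
  have hlow1 : 1 - 2 * t ≤ ∑ k, W k :=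
    one_sub_le_sum_weights τ W hW (hunif 1 le_rfl (by norm_num))
  have hlow2 : 3 / 4 * ∑ k, W k ≤ ∑ k, V k := by
    rw [mul_sum]; exact sum_le_sum fun k _ => hVW k
  linarith

/-- **S1 HOLDS (RH-free): the corner cost law**, from L2, L3 and the assembly. [folklore] -/
theorem cornerCostLaw_holds : CornerCostLaw :=
  cornerCostLaw_of_cornerGap cornerGap_holds lagDensity_holds

/-- **RH-free reduction of the superlinear floor to the plateau bound alone:**
`PlateauBound → SuperlinearFloor`. [folklore] -/
theorem superlinearFloor_of_plateauBound (hS2 : PlateauBound) : SuperlinearFloor :=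
  superlinearFloor_of_cornerGap cornerGap_holds hS2

end Summit.RiemannHypothesis.RiemannHypothesis.Theorems.IntegerScrew.Manifest

end
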